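import Literature.NumberTheory.LFunctions.ConreyIwaniec2002
import HarnessLib

/-!
# The CI-GAPS requirement ledger `H(κ, α)`: close critical pairs of `ζ` with density `(log T)^{−κ}`
# at gap fraction `1 − α` (Conrey–Iwaniec 2002, Thm 1.1/1.2 read as a parametric hypothesis;
# cell ls-idea card K6-5 «R-05 least requirement», door of record CI-GAPS)

Topic `Literature/NumberTheory/LFunctions`. A PREDICATE with parameters + bookkeeping; NOTHING asserted.
Conrey–Iwaniec 2002 [held: paper:arxiv-math_0111012] print two instances of «many close pairs of critical
zeros ⇒ effective lower bound for `L(1,χ)`»: Thm 1.2 for `ζ` at the radius `(π/log γ)(1 − 1/√log γ)`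
with density `(log T)^{−1/5}` (tree: `SubnormalGapsHypothesis c`, `conreyIwaniec2002_theorem12`), and
Thm 1.1 for the class-group family with the general radius `π(1−α)/log γ` (1.19) and density
`c·T log T/(α (log q)^A)` at heights `log T ≥ (log q)^{A+6}` (tree: `conreyIwaniec2002_theorem11`, objects
`ConreyIwaniec2002.HasCloseZero/gapRadius/closeZeroOrdinates/closeZeroCount`). Card K6-5 of cell
ls-idea (lens-6 gen 1; critic A PASS as requirement-ledger card) reads Thm 1.1 at `ψ` trivial
(`ζ_K = ζ·L(s,χ)`, whose critical zeros include those of `ζ`) with `log T = (log q)^{A+6}`, so that the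
hypothesis density is `(log T)^{−κ}/α`, `κ = A/(A+6)`, and the effective exponent is `4A + 18`; the
door's LEAST requirement is then `H(κ, α)` below for SOME `κ < 501/507 ≈ 0.988` (Theorem-1 budget
`4A+18 < 2022`) and ANY fixed `α ∈ (0,1)`. This file types `H(κ, α)` on the tree's objects and proves
its monotonicity in `κ`; the instantiation of Thm 1.1 (ζ_K-zeros ⊇ ζ-zeros, the `T`-choice) is NOT
proved here. «The programme SEARCHES and TYPES; no claim about Landau–Siegel zeros, Theorems 1–2 of
arXiv:2211.02515 or a repaired Margin232 until a kernel theorem says so.»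

## References
* [ConreyIwaniec2002] J. B. Conrey, H. Iwaniec, Acta Arith. 103 (2002) = arXiv:math/0111012: §1
  (1.19)–(1.23), Thm 1.1 (p. 2 L104–L116), Thm 1.2 (p. 3 L8–L20), p. 3 L67–L70.
  [held: paper:arxiv-math_0111012 p0002–p0003]
-/

noncomputable section

namespace Literature.NumberTheory.LFunctions

/-- **`H(κ, α)` — the CI-GAPS requirement ledger** (card K6-5): for all large `T`, the number of
ordinates `2 ≤ γ ≤ T` of critical zeros of `ζ` having a critical neighbour within `π(1−α)/log γ`
(or being multiple) — the tree's `ConreyIwaniec2002.closeZeroOrdinates riemannZeta α T`, radius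
`gapRadius α γ` of (1.19) — is at least `T·(log T)^{1−κ}`, i.e. a `(log T)^{−κ}`-dense set of close
pairs at gap fraction `1 − α` of HALF the mean spacing. Printed instances: Thm 1.2 has density exponent
`κ = 1/5` (with `α = 1/√log γ → 0`); Thm 1.1 accepts `c·T log T/(α(log q)^A)` at `log T ≥ (log q)^{A+6}`.
A PREDICATE in `(κ, α)`; never asserted (no RH-free instance is in print for any `κ < 1`, `α > 0`).
[cite: ConreyIwaniec2002, Theorem 1.1 (1.19)–(1.20) and Theorem 1.2 (1.22)] -/
def SubnormalGapsHypothesisKappa (κ α : ℝ) : Prop :=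
  ∃ T₀ : ℝ, ∀ T : ℝ, T₀ ≤ T →
    T * Real.log T ^ (1 - κ) ≤
      ((ConreyIwaniec2002.closeZeroOrdinates riemannZeta α T).ncard : ℝ)

/-- Monotonicity in the density exponent (proved): `H(κ, α)` implies `H(κ', α)` for every `κ' ≥ κ`
(a larger `κ'` asks for FEWER close pairs; `(log T)^{1−κ'} ≤ (log T)^{1−κ}` once `log T ≥ 1`).
[cite: ConreyIwaniec2002, Theorem 1.1 (1.20)] -/
theorem SubnormalGapsHypothesisKappa.mono {κ κ' α : ℝ} (hκ : κ ≤ κ')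
    (h : SubnormalGapsHypothesisKappa κ α) : SubnormalGapsHypothesisKappa κ' α := by
  obtain ⟨T₀, hT⟩ := h
  refine ⟨max T₀ (Real.exp 1), fun T hTge ↦ ?_⟩
  have hT₀ : T₀ ≤ T := le_trans (le_max_left _ _) hTge
  have hTe : Real.exp 1 ≤ T := le_trans (le_max_right _ _) hTge
  have hTpos : 0 < T := lt_of_lt_of_le (Real.exp_pos 1) hTe
  have hlog : 1 ≤ Real.log T := by
    have := Real.log_le_log (Real.exp_pos 1) hTe
    rwa [Real.log_exp] at this
  have hpow : Real.log T ^ (1 - κ') ≤ Real.log T ^ (1 - κ) :=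
    Real.rpow_le_rpow_of_exponent_le hlog (by linarith)
  exact le_trans (mul_le_mul_of_nonneg_left hpow hTpos.le) (hT T hT₀)

/-- The budget window of card K6-5 (bookkeeping): with `A = 6κ/(1−κ)` the effective exponent of CI
Thm 1.1 is `4A + 18`, and `4A + 18 < 2022` iff `κ < 501/507`. [cite: ConreyIwaniec2002, Theorem 1.1 (1.21)] -/
theorem ciGaps_budget_iff {κ : ℝ} (hκ : κ < 1) :
    4 * (6 * κ / (1 - κ)) + 18 < 2022 ↔ κ < 501 / 507 := by
  have h1 : 0 < 1 - κ := by linarith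
  constructor
  · intro h
    have : 4 * (6 * κ / (1 - κ)) < 2004 := by linarith
    have h2 : 6 * κ / (1 - κ) < 501 := by linarith
    rw [div_lt_iff₀ h1] at h2
    linarith
  · intro h
    have h2 : 6 * κ / (1 - κ) < 501 := by
      rw [div_lt_iff₀ h1]
      linarith
    linarith

end Literature.NumberTheory.LFunctions
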